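import Summits.BirchSwinnertonDyer.BirchSwinnertonDyer.Theorems.GoldfeldAllTwistsTwoConverseTwinQuarterTraceSevenModEightModFourUnion
import Summits.BirchSwinnertonDyer.BirchSwinnertonDyer.Theorems.GoldfeldAllTwistsTwoConverseTwinQuarterTraceAlphaPlusOfPrint
import HarnessLib

set_option linter.dupNamespace false -- namespace `…BirchSwinnertonDyer.BirchSwinnertonDyer…` is the cell's (D-0017 nested layout)
set_option autoImplicit false

/-!
# OBJECT U⁺ (RULING (cccxcii)), file U⁺-R: the `(p/q)`-FREE RANK-AXIS CAPSTONE on the type-α `q ≡ 7 (mod 8)` two-prime family —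
# THEOREM A⁗ on C4 ∪ C7A ∪ a71+ ∪ a75+ from SEVENTEEN named prints, NO `hpq` binder

Cell `bsd-goldfeld`, seat `bsd-goldfeld-s1p-c3x` (gen 16); planner RULING (cccxcii) (1) «GO ON OBJECT U⁺ AS PLANNED» (planner width, named in (cccxci)
CARRIES (f)). `--supports stmt-BirchSwinnertonDyer-20044 --as helper`. Theses-free; ONE theorem by cases, nothing else; 0 def, 0 new fact, no `sorry`.

THE UNION. The first `(p/q)`-FREE two-prime family in the tree, on the α sub-family only: {`q` prime, `q > 3`, `q ≡ 7 (mod 8)`, `(q/7) = −1`} ×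
{`p` prime, `p ≡ 1 (mod 4)`, `(−7/p) = +1`, `−7 ∉ 𝔽_p^{×4}`}, `W ≅ 49a1^{(−2qp)}`: since `p ≠ q` the symbol `(p/q)` is `±1`
(`jacobiSym.eq_one_or_neg_one`); at `(p/q) = −1` U1 `analyticRank_eq_one_twoPrimesTwist_sevenModEight_modFour_of_print` (OBJECT U, p681968; TYPE-FREE,
`p`-mod-`8`-free) and at `(p/q) = +1` Z⁺-2 `analyticRank_eq_one_twoPrimesTwist_alphaPlus_modFour_of_print` (OBJECT A7⁺, p700873; type α, `p ≡ 1 (mod 4)`)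
give **`r_an(W) = rank W(ℚ) = 1` and `Ш(W)` finite for every `W ≅ 49a1^{(−2qp)}`** — by name, one case split. BINDERS = U1's SEVENTEEN
{`hCST hGZ h12 h44 h13 h14 hS31 hnew hM hBT hBF hGZK hEta hEta₀ hD hBCST hpar`} LETTER-IDENTICAL (union-by-name; `h13` is U1's pass-through only — no new
`h13`- or `hCT`-consuming declaration), cell binders = U1's ∪ {`hα`} ∖ {`hpq`}.
HONEST FRAMING: `(p/q)`-free on the α sub-family ONLY; type β at `(p/q) = +1` is NOT covered (b71+ = second descent, director width; b75+ ⊂ B5⁺, offered,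
unordered at writing); a twist-density-ZERO two-parameter family modulo the seventeen named prints (SELMER-DRIFT ceiling (ccclxxxi)); FRONTIER-grade, never
distance-to-summit; items 19140 / 19350 / 20044 unchanged and NOT closed; BSD is not proved by any of this.

References: [Gross1984] §§4–5; [GrossLMS1991] Prop. 5.3; [GrossZagier1986] I.(6.3); [CoatesLiTianZhai2015] Thm 1.2–1.4, 4.4; [CaiShuTian2014] Thm 1.1;
[LiMa2008] Thm 0.4; [BurungaleCastellaSkinnerTian2022] Thm A, Rem. D.
-/

noncomputable section

open scoped Classical

open WeierstrassCurve NumberField Literature.NumberTheory Literature.NumberTheory.EllipticCurves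
  Literature.NumberTheory.EllipticCurves.ModularForms Literature.NumberTheory.EllipticCurves.CaiShuTian2014
  Literature.NumberTheory.EllipticCurves.CoatesLiTianZhai2015

namespace Summit.BirchSwinnertonDyer.BirchSwinnertonDyer.Theorems.GoldfeldGoodTwists

section Union

variable (hCST : thm11_ringClassChar)
  (hGZ : ∀ (N : ℕ) [NeZero N] (W : WeierstrassCurve ℚ) (K : Type) [Field K] [NumberField K], gross_zagier N W K)
  (h12 : thm12_fullBSD_twist) (h44 : thm44_ord_two_LAlg) (h13 : thm13_ord_two_LAlg) (h14 : thm14_rankOne_twist)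
  (hS31 : bsdTriple_of_rank_le_one_of_conductor_lt) (hnew : exists_isNewformOf) (hM : OptimalCurveManinCertificate cm7)
  (hBT : burungaleTian_analyticRank_eq_zero_of_selmerCorank_eq_zero_of_hasCM) (hBF : bsdTriple_of_hasCM_of_L_one_ne_zero)
  (hGZK : rank_eq_analyticRank_of_analyticRank_le_one) (hEta : x049_heegner_norm_x_sub_two_not_mem)
  (hEta₀ : x049_x_sub_two_eq_etaQuotient) (hD : deuring_etaQuotient49_heegner_generates_conjPrime)
  (hBCST : BurungaleCastellaSkinnerTian2022.thmA_analyticRank_eq_one_of_selmerCorank_eq_one)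
  (hpar : ∀ (V : WeierstrassCurve ℚ) [V.IsElliptic], p_parity V 2)
include hCST hGZ h12 h44 h13 h14 hS31 hnew hM hBT hBF hGZK hEta hEta₀ hD hBCST hpar

/-- **`r_an(W) = 1`, `rank W(ℚ) = 1`, `Ш(W)` finite for every `W ≅ 49a1^{(−2qp)}` on the type-α `q ≡ 7 (mod 8)` two-prime family, WHATEVER `(p/q)`**
(`q > 3` prime, `q ≡ 7 (mod 8)`, `(q/7) = −1`; `p ≡ 1 (mod 4)` prime, `(−7/p) = +1`, `−7` not a fourth power mod `p`; NO `(p/q)` binder), from print —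
by cases on `jacobiSym p q = ±1` onto U1 `analyticRank_eq_one_twoPrimesTwist_sevenModEight_modFour_of_print` (`(p/q) = −1`) ∣ Z⁺-2
`analyticRank_eq_one_twoPrimesTwist_alphaPlus_modFour_of_print` (`(p/q) = +1`). SEVENTEEN print binders (U1's, by name), nothing else. A WITNESS FAMILY of
twist-density zero; type β at `(p/q) = +1` NOT covered; not a closer of any item; BSD is not proved by any of this. [cite: CoatesLiTianZhai2015, Thm. 1.2 and Thm. 1.4]
[cite: GrossZagier1986, Thm. I.(6.3)] [cite: GrossLMS1991, Prop. 5.3] [cite: LiMa2008, Thm. 0.4] [cite: BurungaleCastellaSkinnerTian2022, Thm. A (p. 326)] -/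
theorem analyticRank_eq_one_twoPrimesTwist_sevenModEightAlpha_modFour_symbolFree_of_print
    {q p : ℕ} (hq : q.Prime) (h3 : 3 < q) (hq8 : q % 8 = 7) (hq7 : jacobiSym q 7 = -1)
    [Fact p.Prime] (hp4 : p % 4 = 1) (hp7 : legendreSym p (-7) = 1) (hα : ¬ ∃ x : ZMod p, x ^ 4 = -7)
    (W : WeierstrassCurve ℚ) [W.IsElliptic] (C : VariableChange ℚ) (hC : C • W = cm7.quadraticTwist (-(2 * (q : ℚ) * p))) :
    W.analyticRank = 1 ∧ W.mordellWeilRank = 1 ∧ Finite W.sha := by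
  have hp : p.Prime := Fact.out
  have hne : p ≠ q := by rintro rfl; omega
  have hgcd : Int.gcd (p : ℤ) q = 1 := by rw [Int.gcd_natCast_natCast]; exact (Nat.coprime_primes hp hq).mpr hne
  rcases jacobiSym.eq_one_or_neg_one hgcd with hpq | hpq
  · exact analyticRank_eq_one_twoPrimesTwist_alphaPlus_modFour_of_print hCST hGZ h12 h44 h14 hS31 hnew hM hBT hBF hGZK hEta hEta₀ hD hBCST hpar hq
      hq8 hq7 hp4 hp7 hα hpq W C hC
  · exact analyticRank_eq_one_twoPrimesTwist_sevenModEight_modFour_of_print hCST hGZ h12 h44 h13 h14 hS31 hnew hM hBT hBF hGZK hEta hEta₀ hD hBCST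
      hpar hq h3 hq8 hq7 hp4 hp7 hpq W C hC

end Union

end Summit.BirchSwinnertonDyer.BirchSwinnertonDyer.Theorems.GoldfeldGoodTwists

end
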